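import Summits.NavierStokesRegularity.NavierStokesRegularity.Theorems.ScenarioCensusSilenceMeterVolume
import HarnessLib

/-!
# LINE g16-4 «silence-meter» REV 2 port, part 4/4: §I (cont.) REV 2 census rows `Row_A2siV` / `Row_A2siW` (proved); §J the fixed-level residual `Row_A2siQ` (OPEN; `⇒ Row_A2arP`); §K
# sparseness dictionary (`Row_A2siS`, proved), REV 2 bridge; census KEYS `Row_A2si0` / `Row_A2siE` / `Row_A2siP` / `Row_A2siU` / `Row_A2siV` / `Row_A2siW` / `Row_A2siS` + `_excluded`,
# `Row_A2siN` / `Row_A2siQ` (OPEN), edges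

Re-homed for the scenario census (typer seat ns-census-typer-1 g9; the cells A2si0 / A2siE / A2siP / A2siU (LINE g16-4, item 68, census v1.98) and A2siV / A2siW / A2siS (REV 2,
item 72, census v1.101) are MEMBERS OF RECORD «DECIDED IN KERNEL IN FILES» of block A2 (critic PASS; ref PRE-CHECK ✓ §18.8; lead label); this port makes them TREE-decided):
VERBATIM PORT of ns-idea-2 LINE g16-4 «silence-meter» REV 2, `pub/ideators/ns-idea-2/lines/silence-meter/line-silence-meter.rev2.lean` sha16 72a7ac62b938520d (1078 l. =
rev 1 89ff24c1f2a7581c + §I–§K, lean check rc 0, 0 sorry), split for the 400-line rule into `ScenarioCensusSilenceMeter` (§A–§E) → `…SilenceMeterRows` (§F–§G) →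
`…SilenceMeterVolume` (§I laws) → `…SilenceMeterVolumeRows` (§I rows, §J, §K + census KEYS).  Lean text VERBATIM in namespace `…Theorems.ScenarioCensus.SilenceMeter` (the
line's `…Lines.SilenceMeter` re-homed); port edits: `local notation "E3"` → `abbrev E3` (typer lint), `set_option linter.unusedVariables false` dropped (the record: a port
must drop it; unused binders `_`-prefixed where the linter asks, proof text only), the `variable {C} {u}` line and `open MeasureTheory` repeated per part, the instrument `amp`
(+ `amp_nonneg`, `amp_le`) and the one-limit Liouville law `eq_zero_of_blowdownLimit_zero`, shared VERBATIM with the epoch-meter port, taken BY NAME (`EpochMeter.…`),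
`@[conjecture]` on the OPEN rows `Row_A2siN` / `Row_A2siQ` and on the restated residuals `Row_A2arP` / `EnvelopeLiouville` (typed only), one-line docstrings added (gate
lint).  Statements untouched.

No census VALUE is moved here (the cells become TREE-decided by name; booking is the lead's); NS regularity is NOT proved; (L′) ⟨10661⟩ is untouched; no
summit statement is proved by this file. Lemmas that restate already-landed tree declarations are taken BY NAME (gate lint `dedup.landed`): `amp` = `EpochMeter.amp`, `amp_nonneg` = `EpochMeter.amp_nonneg`, `amp_le` = `EpochMeter.amp_le`, `eq_zero_of_blowdownLimit_zero` = `EpochMeter.eq_zero_of_blowdownLimit_zero`.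
-/

-- the summit and its single problem share the name `NavierStokesRegularity` (D-0017 nested layout)
set_option linter.dupNamespace false

noncomputable section

open Set Function Filter Metric
open scoped Topology
open Literature.Analysis.FluidPDE
open Summit.NavierStokesRegularity.NavierStokesRegularity.Theorems

namespace Summit.NavierStokesRegularity.NavierStokesRegularity.Theorems.ScenarioCensus.SilenceMeter

open MeasureTheory

variable {C : ℝ} {u : ℝ → E3 → E3}

/-! ### REV 2 census rows (volume readings) -/

/-- **Row A2si-V** (RECURRENT POSITIVE-VOLUME SILENCE, EXCLUDED — PROVED): for some similarity ball `B̄(η₀, ρ)`, some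
`v > 0`, some far-past times `s_k → −∞` and levels `δ_k → 0`, the set of profile positions `η ∈ B̄(η₀, ρ)` with reading
`√(−s_k)‖u(s_k, √(−s_k)η)‖ ≤ δ_k` has volume `≥ v` for every `k` ⇒ `u ≡ 0`. -/
def Row_A2siV : Prop :=
  ∀ (C : ℝ) (u : ℝ → E3 → E3), IsTypeIAncientMild C u →
    (∃ (η₀ : E3) (ρ v : ℝ), 0 < v ∧ ∃ (s δ : ℕ → ℝ), (∀ k, s k < 0) ∧ Tendsto s atTop atBot ∧
      Tendsto δ atTop (𝓝 0) ∧
      ∀ k, ENNReal.ofReal v ≤ volume {η : E3 | η ∈ Metric.closedBall η₀ ρ ∧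
        Real.sqrt (-s k) * ‖u (s k) (Real.sqrt (-s k) • η)‖ ≤ δ k}) →
    ∀ t < 0, ∀ x, u t x = 0

/-- **Row A2si-W** (QUIET VOLUME AT THE UNIVERSAL LEVEL, EXCLUDED — PROVED): for every `C`, `η₀`, `ρ` and `v > 0` there
is `f > 0` such that: `f`-quiet sets of volume `≥ v` in `√(−s_k)·B̄(η₀, ρ)` along some `s_k → −∞` ⇒ `u ≡ 0`. -/
def Row_A2siW : Prop :=
  ∀ (C : ℝ) (η₀ : E3) (ρ v : ℝ), 0 < v → ∃ f > (0 : ℝ), ∀ (u : ℝ → E3 → E3), IsTypeIAncientMild C u →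
    (∃ s : ℕ → ℝ, (∀ k, s k < 0) ∧ Tendsto s atTop atBot ∧
      ∀ k, ENNReal.ofReal v ≤ volume {η : E3 | η ∈ Metric.closedBall η₀ ρ ∧
        Real.sqrt (-s k) * ‖u (s k) (Real.sqrt (-s k) • η)‖ ≤ f}) →
    ∀ t < 0, ∀ x, u t x = 0

/-- **Row A2siV holds.** -/
theorem row_A2siV : Row_A2siV := by
  intro C u hu ⟨η₀, ρ, v, hv, s, δ, hs0, hslim, hδ, hq⟩
  exact eq_zero_of_silentInVolumeAlong hu (η₀ := η₀) (ρ := ρ) (s := s) hv ⟨hs0, hslim, δ, hδ, hq⟩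

/-- **Row A2siW holds.** -/
theorem row_A2siW : Row_A2siW := by
  intro C η₀ ρ v hv
  obtain ⟨f, hf, hfl⟩ := universal_quietVolume C η₀ ρ hv
  refine ⟨f, hf, fun u hu ⟨s, hs0, hslim, hq⟩ => ?_⟩
  by_contra hne
  push Not at hne
  obtain ⟨t, ht, x, hx⟩ := hne
  obtain ⟨k, hlt⟩ := hfl u hu ⟨t, ht, x, hx⟩ s hs0 hslim
  exact absurd (hq k) (not_le.2 hlt)

/-- Nesting (PROVED): the volume row implies the sup row of § F — REV 2 genuinely extends REV 1 (`ρ > 0` gives the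
ball positive volume). -/
theorem row_A2si0_of_row_A2siV (h : Row_A2siV) : Row_A2si0 := by
  intro C u hu ⟨η₀, ρ, hρ, s, δ, hs0, hslim, hδ, hq⟩
  have hvol : 0 < (volume (Metric.closedBall η₀ ρ)).toReal :=
    ENNReal.toReal_pos (Metric.measure_closedBall_pos volume η₀ hρ).ne'
      (isCompact_closedBall η₀ ρ).measure_lt_top.ne
  have hsil : SilentAlong u η₀ ρ s := ⟨hs0, hslim, δ, hδ, fun k x hx => hq k x (by
    simpa [simBall, Metric.mem_closedBall, dist_eq_norm] using hx)⟩
  obtain ⟨-, -, δ', hδ', hq'⟩ := silentInVolumeAlong_of_silentAlong hsil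
  exact h C u hu ⟨η₀, ρ, _, hvol, s, δ', hs0, hslim, hδ', fun k => (hq' k).trans (measure_mono fun η hη => hη)⟩

/-- Nesting (PROVED): the universal-level volume row implies the vanishing-level volume row (eventually `δ_k ≤ f`;
shift the sequence). -/
theorem row_A2siV_of_row_A2siW (h : Row_A2siW) : Row_A2siV := by
  intro C u hu ⟨η₀, ρ, v, hv, s, δ, hs0, hslim, hδ, hq⟩
  obtain ⟨f, hf, hfl⟩ := h C η₀ ρ v hv
  have hev : ∀ᶠ k in atTop, δ k ≤ f := hδ.eventually (ge_mem_nhds hf)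
  obtain ⟨k₀, hk₀⟩ := hev.exists_forall_of_atTop
  refine hfl u hu ⟨fun k => s (k + k₀), fun k => hs0 _, hslim.comp (tendsto_add_atTop_nat k₀), fun k => ?_⟩
  refine (hq (k + k₀)).trans (measure_mono fun η hη => ⟨hη.1, hη.2.trans (hk₀ _ (Nat.le_add_left _ _))⟩)

/-! ## J. (REV 2) The FIXED-LEVEL residual: one eventually ε-quiet receding ball — OPEN, and the hardest cell of the
amplitude-quietness series -/

/-- **Row A2si-Q** (ONE receding similarity ball EVENTUALLY `ε`-QUIET at a FIXED level `ε < 1`, typed OPEN — not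
claimed): `∃ ε < 1, ∃ η₀, ∃ ρ > 0, ∃ T < 0, ∀ s < T, ∀ x ∈ √(−s)·B̄(η₀, ρ), √(−s)‖u(s,x)‖ ≤ ε` ⇒ `u ≡ 0`.  The blow-down
transports the hypothesis to an `ε`-quiet BALL of every limit slice — no contradiction is available at positive level
(REV 1 must-fail 36).  PROVED below: this cell CONTAINS g16-2's residual `Row_A2arP` and hence the envelope-Liouville
cell — it is the hardest amplitude-quietness cell of the series g16-1 … g16-4. -/
@[conjecture] def Row_A2siQ : Prop :=
  ∀ (C : ℝ) (u : ℝ → E3 → E3), IsTypeIAncientMild C u →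
    (∃ ε : ℝ, ε < 1 ∧ ∃ (η₀ : E3) (ρ : ℝ), 0 < ρ ∧ ∃ T < 0, ∀ s < T, ∀ x : E3,
      ‖x - Real.sqrt (-s) • η₀‖ ≤ ρ * Real.sqrt (-s) → Real.sqrt (-s) * ‖u s x‖ ≤ ε) →
    ∀ t < 0, ∀ x, u t x = 0

/-- **Placement** (PROVED): `Row_A2siQ → Row_A2arP` — an exterior-quiet element (g16-2's open cell: `ε`-quiet outside
the paraboloid of aperture `K` before `T`) is `ε`-quiet on the receding unit ball centred at similarity position
`(|K| + 1)·e₀`, which lies outside that paraboloid. -/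
theorem row_A2arP_of_row_A2siQ (h : Row_A2siQ) : Row_A2arP := by
  intro C u hu ⟨ε, hε1, K, T, hT, hq⟩
  refine h C u hu ⟨ε, hε1, (|K| + 1) • e₀, 1, one_pos, T, hT, fun s hs x hx => hq s hs x ?_⟩
  -- `x` in the unit receding ball around `√(−s)(|K|+1)e₀` has `‖x‖ ≥ |K|√(−s) ≥ K√(−s)`
  have hsq : 0 ≤ Real.sqrt (-s) := Real.sqrt_nonneg _
  have hc : ‖Real.sqrt (-s) • ((|K| + 1) • e₀)‖ = (|K| + 1) * Real.sqrt (-s) := by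
    rw [norm_smul, norm_smul, norm_e₀, mul_one, Real.norm_of_nonneg hsq,
      Real.norm_of_nonneg (by positivity : (0:ℝ) ≤ |K| + 1)]; ring
  have h1 : (|K| + 1) * Real.sqrt (-s) - 1 * Real.sqrt (-s) ≤ ‖x‖ := by
    have := norm_sub_norm_le (Real.sqrt (-s) • ((|K| + 1) • e₀)) x
    rw [hc, norm_sub_rev] at this
    linarith
  calc K * Real.sqrt (-s) ≤ |K| * Real.sqrt (-s) := mul_le_mul_of_nonneg_right (le_abs_self K) hsq
    _ = (|K| + 1) * Real.sqrt (-s) - 1 * Real.sqrt (-s) := by ring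
    _ ≤ ‖x‖ := h1

/-- Hence (PROVED): `Row_A2siQ → EnvelopeLiouville` — the fixed-level one-ball cell is at least Type-I-envelope-hard. -/
theorem envelopeLiouville_of_row_A2siQ (h : Row_A2siQ) : EnvelopeLiouville :=
  envelopeLiouville_of_row_A2arP (row_A2arP_of_row_A2siQ h)

/-! ### REV 2 controls -/

/-- The zero field is silent in volume at the full volume of any ball (readings honest; `u ≠ 0` is what the laws use). -/
theorem control_zero_silentInVolume (η₀ : E3) (ρ : ℝ) {s : ℕ → ℝ} (hs0 : ∀ k, s k < 0)
    (hslim : Tendsto s atTop atBot) :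
    SilentInVolumeAlong (fun _ _ => (0 : E3)) η₀ ρ (volume (Metric.closedBall η₀ ρ)).toReal s :=
  silentInVolumeAlong_of_silentAlong (control_zero_silent η₀ ρ hs0 hslim)

/-- Quiet sets live inside the ball, so their volume never exceeds the ball's: `LoudFills` at `v` larger than the
ball's volume is automatic, and the content of `loudFills_of_ne_zero` is the regime `v ≪ |B̄(η₀, ρ)|`. -/
theorem volume_quietSet_le (u : ℝ → E3 → E3) (δ : ℝ) (η₀ : E3) (ρ s : ℝ) :
    volume (quietSet u δ η₀ ρ s) ≤ volume (Metric.closedBall η₀ ρ) :=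
  measure_mono fun _ hη => hη.1

/-! ## K. (REV 2) SPARSENESS DICTIONARY — the rows in the tree's printed sparseness vocabulary
(`BFG2019.IsVolumeSparseAround`, Bradshaw–Farhat–Grujić 2019 Def. 13, BY NAME)

In print, «`S` is 3D `δ`-sparse around `x₀` at scale `r`» means `|S ∩ B(x₀, r)| ≤ δ|B(x₀, r)|` (Grujić 2013; Bradshaw–Farhat–
Grujić 2019 Def. 13 = tree `BFG2019.IsVolumeSparseAround`; Albritton–Bradshaw 2022 Def. 1.1).  The printed theorems live on the
REGULARITY side: a blowing-up finite-energy solution FAILS to be sparse near `T*` at scales `√(T* − t)·ℓ̄`, `ℓ̄ ≫ 1`, for SOME ball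
(Albritton–Bradshaw Cor. 1.3), while it IS sparse at scales `a·ℓ₀(t)` (Thm. 1.4 / BFG Thm. 26).  The universal quiet-volume law
gives the LIOUVILLE-side statement for singularity MODELS at exactly the parabolic scale and in EVERY ball: `Row_A2siS` — for every
`C`, `η₀`, `ρ > 0` and ratio `δ < 1` there is a level `f(C, η₀, ρ, δ) > 0` such that NO nonzero `u ∈ A_C` has its `f`-LOUD set
(similarity coordinates) `δ`-sparse around `η₀` at scale `ρ` along a sequence `s_k → −∞`; and (`loud_not_sparse_of_ne_zero`) at EVERY
time `s < T(u)` the `f`-loud set of a nonzero element is NOT `δ`-sparse around `η₀` at scale `ρ` — singularity models are NOWHERE SPARSE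
at the self-similar scale.  (Level conventions differ from print: there the level is RELATIVE, `½‖·‖_∞` or an `L^p`-mass fraction;
here it is the ABSOLUTE scale-invariant level `f`.) -/

/-- Sparse loud set ⇒ large quiet set (PROVED; measure bookkeeping): if the `f`-loud set at time `s` is `δ`-sparse around `η₀` at scale
`ρ`, the `f`-quiet set in `B̄(η₀, ρ)` has volume `≥ |B(η₀, ρ)| − δ|B(η₀, ρ)|`. -/
theorem sparseDefect_le_volume_quietSet {f : ℝ} {η₀ : E3} {ρ δ s : ℝ}
    (hsp : BFG2019.IsVolumeSparseAround {η : E3 | f < EpochMeter.amp u s (Real.sqrt (-s) • η)} η₀ ρ δ) :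
    volume (Metric.ball η₀ ρ) - ENNReal.ofReal δ * volume (Metric.ball η₀ ρ) ≤ volume (quietSet u f η₀ ρ s) := by
  set L : Set E3 := {η : E3 | f < EpochMeter.amp u s (Real.sqrt (-s) • η)} with hL
  have hsp' : volume (L ∩ Metric.ball η₀ ρ) ≤ ENNReal.ofReal δ * volume (Metric.ball η₀ ρ) := hsp
  have hcover : volume (Metric.ball η₀ ρ) ≤ volume (quietSet u f η₀ ρ s) + volume (L ∩ Metric.ball η₀ ρ) := by
    calc volume (Metric.ball η₀ ρ) ≤ volume (quietSet u f η₀ ρ s ∪ (L ∩ Metric.ball η₀ ρ)) :=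
          measure_mono fun η hη => by
            by_cases hl : f < EpochMeter.amp u s (Real.sqrt (-s) • η)
            · exact Or.inr ⟨hl, hη⟩
            · exact Or.inl ⟨Metric.ball_subset_closedBall hη, not_lt.1 hl⟩
      _ ≤ volume (quietSet u f η₀ ρ s) + volume (L ∩ Metric.ball η₀ ρ) := measure_union_le _ _
  calc volume (Metric.ball η₀ ρ) - ENNReal.ofReal δ * volume (Metric.ball η₀ ρ)
        ≤ volume (Metric.ball η₀ ρ) - volume (L ∩ Metric.ball η₀ ρ) := tsub_le_tsub_left hsp' _
    _ ≤ volume (quietSet u f η₀ ρ s) := tsub_le_iff_right.2 hcover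

/-- The sparseness defect `|B(η₀, ρ)| − δ|B(η₀, ρ)|` is a positive real for `ρ > 0`, `δ < 1` (balls in `ℝ³` have finite positive
volume). -/
theorem sparseDefect_pos (η₀ : E3) {ρ δ : ℝ} (hρ : 0 < ρ) (hδ : δ < 1) :
    0 < (volume (Metric.ball η₀ ρ) - ENNReal.ofReal δ * volume (Metric.ball η₀ ρ)).toReal := by
  have hm0 : volume (Metric.ball η₀ ρ) ≠ 0 := (Metric.measure_ball_pos volume η₀ hρ).ne'
  have hmT : volume (Metric.ball η₀ ρ) ≠ ⊤ := measure_ball_lt_top.ne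
  have hlt : ENNReal.ofReal δ * volume (Metric.ball η₀ ρ) < volume (Metric.ball η₀ ρ) := by
    have h := ENNReal.mul_lt_mul_right hm0 hmT (ENNReal.ofReal_lt_one.2 hδ)
    rw [mul_one, mul_comm] at h
    exact h
  exact ENNReal.toReal_pos (tsub_pos_iff_lt.2 hlt).ne' (ne_top_of_le_ne_top hmT tsub_le_self)

/-- **Row A2si-S** (SPARSE LOUD SETS along a sequence, EXCLUDED — PROVED; stated over the tree's `BFG2019.IsVolumeSparseAround` BY NAME):
for every `C`, every similarity position `η₀`, scale `ρ > 0` and ratio `δ < 1` there is a level `f > 0` such that: the `f`-loud set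
`{η : f < √(−s_k)‖u(s_k, √(−s_k)η)‖}` `δ`-sparse around `η₀` at scale `ρ` for all `k`, along some `s_k → −∞` ⇒ `u ≡ 0`. -/
def Row_A2siS : Prop :=
  ∀ (C : ℝ) (η₀ : E3) (ρ δ : ℝ), 0 < ρ → δ < 1 → ∃ f > (0 : ℝ), ∀ (u : ℝ → E3 → E3), IsTypeIAncientMild C u →
    (∃ s : ℕ → ℝ, (∀ k, s k < 0) ∧ Tendsto s atTop atBot ∧
      ∀ k, BFG2019.IsVolumeSparseAround
        {η : E3 | f < Real.sqrt (-s k) * ‖u (s k) (Real.sqrt (-s k) • η)‖} η₀ ρ δ) →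
    ∀ t < 0, ∀ x, u t x = 0

/-- Nesting (PROVED, measure bookkeeping only): the universal-level volume row gives the sparseness row. -/
theorem row_A2siS_of_row_A2siW (h : Row_A2siW) : Row_A2siS := by
  intro C η₀ ρ δ hρ hδ
  obtain ⟨f, hf, hfl⟩ := h C η₀ ρ _ (sparseDefect_pos η₀ hρ hδ)
  refine ⟨f, hf, fun u hu ⟨s, hs0, hslim, hsp⟩ => hfl u hu ⟨s, hs0, hslim, fun k => ?_⟩⟩
  exact ENNReal.ofReal_toReal_le.trans
    ((sparseDefect_le_volume_quietSet (u := u) (hsp k)).trans (measure_mono fun η hη => ⟨hη.1, hη.2⟩))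

/-- **Row A2siS holds.** -/
theorem row_A2siS : Row_A2siS := row_A2siS_of_row_A2siW row_A2siW

/-- **NOWHERE SPARSE** (PROVED; the N1 datum in printed vocabulary): with `f = f(C, η₀, ρ, δ)`, every NONZERO `u ∈ A_C` has, at EVERY
time before some `T(u) < 0`, an `f`-loud set that is NOT `δ`-sparse around `η₀` at scale `ρ` (similarity coordinates). -/
theorem loud_not_sparse_of_ne_zero (C : ℝ) (η₀ : E3) {ρ δ : ℝ} (hρ : 0 < ρ) (hδ : δ < 1) :
    ∃ f > (0 : ℝ), ∀ u : ℝ → E3 → E3, IsTypeIAncientMild C u → (∃ t < (0 : ℝ), ∃ x, u t x ≠ 0) →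
      ∃ T < (0 : ℝ), ∀ s < T,
        ¬ BFG2019.IsVolumeSparseAround {η : E3 | f < Real.sqrt (-s) * ‖u s (Real.sqrt (-s) • η)‖} η₀ ρ δ := by
  obtain ⟨f, hf, hfl⟩ := loudFills_of_ne_zero C η₀ ρ (sparseDefect_pos η₀ hρ hδ)
  refine ⟨f, hf, fun u hu hne => ?_⟩
  obtain ⟨T, hT, hq⟩ := hfl u hu hne
  refine ⟨T, hT, fun s hs hsp => ?_⟩
  have h1 := sparseDefect_le_volume_quietSet (u := u) hsp
  exact absurd (ENNReal.ofReal_toReal_le.trans h1) (not_le.2 (hq s hs))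

/-! ### REV 2 bridge: the rung decides the four REV 2 rows (BY NAME) -/

/-- (L′) decides the REV 2 rows (informational). -/
theorem rows_rev2_of_L' (hL : ∀ (C : ℝ) (u : ℝ → E3 → E3), IsTypeIAncientMild C u → ∀ t < 0, ∀ x, u t x = 0) :
    Row_A2siV ∧ Row_A2siW ∧ Row_A2siQ ∧ Row_A2siS :=
  ⟨fun C u hu _ => hL C u hu,
   fun C _ _ _ _ => ⟨1, one_pos, fun u hu _ => hL C u hu⟩,
   fun C u hu _ => hL C u hu,
   fun C _ _ _ _ _ => ⟨1, one_pos, fun u hu _ => hL C u hu⟩⟩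

/-- The rung decides the REV 2 rows (informational). -/
theorem rows_rev2_of_rung (hL : Theses.SymmetryModuliCount.TypeIAncientLiouville) :
    Row_A2siV ∧ Row_A2siW ∧ Row_A2siQ ∧ Row_A2siS :=
  rows_rev2_of_L' fun C u hu => hL C u ((isTypeIAncientMild_iff).1 hu)

end Summit.NavierStokesRegularity.NavierStokesRegularity.Theorems.ScenarioCensus.SilenceMeter

namespace Summit.NavierStokesRegularity.NavierStokesRegularity.Theorems.ScenarioCensus

/-! ## Census KEYS (ns `…Theorems.ScenarioCensus`): instrument SILENCE METER (block A2) — TREE-decided cells A2si0 / A2siE / A2siP / A2siU / A2siV / A2siW / A2siS, OPEN rows A2siN / A2siQ -/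

/-- **Cell A2si0** (silent along ONE receding similarity-ball sequence ⇒ `u ≡ 0`): `:= SilenceMeter.Row_A2si0`. DECIDED. -/
def Row_A2si0 : Prop := SilenceMeter.Row_A2si0
/-- A2si0 is EXCLUDED (decided in the tree): `SilenceMeter.row_A2si0`. -/
theorem row_A2si0_excluded : Row_A2si0 := SilenceMeter.row_A2si0

/-- **Cell A2siE**: `:= SilenceMeter.Row_A2siE`. DECIDED. -/
def Row_A2siE : Prop := SilenceMeter.Row_A2siE
/-- A2siE is EXCLUDED (decided in the tree): `SilenceMeter.row_A2siE`. -/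
theorem row_A2siE_excluded : Row_A2siE := SilenceMeter.row_A2siE

/-- **Cell A2siP** (silence OUTSIDE a paraboloid along a sequence — the level-`0` edge of `Row_A2arP`): `:= SilenceMeter.Row_A2siP`. DECIDED. -/
def Row_A2siP : Prop := SilenceMeter.Row_A2siP
/-- A2siP is EXCLUDED (decided in the tree): `SilenceMeter.row_A2siP`. -/
theorem row_A2siP_excluded : Row_A2siP := SilenceMeter.row_A2siP

/-- **Cell A2siU**: `:= SilenceMeter.Row_A2siU`. DECIDED. -/
def Row_A2siU : Prop := SilenceMeter.Row_A2siU
/-- A2siU is EXCLUDED (decided in the tree): `SilenceMeter.row_A2siU`. -/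
theorem row_A2siU_excluded : Row_A2siU := SilenceMeter.row_A2siU

/-- **Cell A2siV** (REV 2 · recurrent POSITIVE-VOLUME silence on a receding similarity ball ⇒ `u ≡ 0`): `:= SilenceMeter.Row_A2siV`. DECIDED. -/
def Row_A2siV : Prop := SilenceMeter.Row_A2siV
/-- A2siV is EXCLUDED (decided in the tree): `SilenceMeter.row_A2siV`. -/
theorem row_A2siV_excluded : Row_A2siV := SilenceMeter.row_A2siV

/-- **Cell A2siW** (REV 2): `:= SilenceMeter.Row_A2siW`. DECIDED. -/
def Row_A2siW : Prop := SilenceMeter.Row_A2siW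
/-- A2siW is EXCLUDED (decided in the tree): `SilenceMeter.row_A2siW`. -/
theorem row_A2siW_excluded : Row_A2siW := SilenceMeter.row_A2siW

/-- **Cell A2siS** (REV 2 · sparseness-dictionary form): `:= SilenceMeter.Row_A2siS`. DECIDED. -/
def Row_A2siS : Prop := SilenceMeter.Row_A2siS
/-- A2siS is EXCLUDED (decided in the tree): `SilenceMeter.row_A2siS`. -/
theorem row_A2siS_excluded : Row_A2siS := SilenceMeter.row_A2siS

/-- **Row A2siN** — typed only: `:= SilenceMeter.Row_A2siN`. OPEN (no witness, no proof). -/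
@[conjecture] def Row_A2siN : Prop := SilenceMeter.Row_A2siN

/-- **Row A2siQ** (REV 2 · one eventually `ε`-quiet receding ball, fixed `ε < 1`; `⇒ Row_A2arP ⇒ EnvelopeLiouville`) — typed only: `:= SilenceMeter.Row_A2siQ`. OPEN. -/
@[conjecture] def Row_A2siQ : Prop := SilenceMeter.Row_A2siQ

/-- Lattice edges at key level: A2siU → A2si0 → A2siE, A2siW → A2siV → A2si0, A2siW → A2siS (`SilenceMeter.row_A2si0_of_row_A2siU` / `row_A2siE_of_row_A2si0` /
`row_A2siV_of_row_A2siW` / `row_A2si0_of_row_A2siV` / `row_A2siS_of_row_A2siW`). -/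
theorem row_A2si0_of_row_A2siU : Row_A2siU → Row_A2si0 := SilenceMeter.row_A2si0_of_row_A2siU
/-- See `row_A2si0_of_row_A2siU`. -/
theorem row_A2siE_of_row_A2si0 : Row_A2si0 → Row_A2siE := SilenceMeter.row_A2siE_of_row_A2si0
/-- See `row_A2si0_of_row_A2siU`. -/
theorem row_A2siV_of_row_A2siW : Row_A2siW → Row_A2siV := SilenceMeter.row_A2siV_of_row_A2siW
/-- See `row_A2si0_of_row_A2siU`. -/
theorem row_A2si0_of_row_A2siV : Row_A2siV → Row_A2si0 := SilenceMeter.row_A2si0_of_row_A2siV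
/-- See `row_A2si0_of_row_A2siU`. -/
theorem row_A2siS_of_row_A2siW : Row_A2siW → Row_A2siS := SilenceMeter.row_A2siS_of_row_A2siW

end Summit.NavierStokesRegularity.NavierStokesRegularity.Theorems.ScenarioCensus

end
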